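import Mathlib
import Summits.NavierStokesRegularity.NavierStokesRegularity.Theorems.EulerZoomLiouvillePowerGaugeEulerLiouvilleHoopDisc
import Summits.NavierStokesRegularity.NavierStokesRegularity.Theorems.EulerZoomLiouvillePowerGaugeEulerLiouvilleHoopProfileIsometry
import Summits.NavierStokesRegularity.NavierStokesRegularity.Theorems.EulerZoomLiouvillePowerGaugeEulerLiouvilleHoopAxisRadialLaw
import Literature.Analysis.FluidPDE.PeriodicLerayProfileGradient
import Literature.Analysis.FluidPDE.Wei2016SwirlGradBound
import HarnessLib

/-!
# Hoop core — K-TJ′ tools: rigid motions of profiles, the Dirichlet energy of a moved cylinder, and size bounds of the axis-law terms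

Sub-problem `NavierStokesRegularity`, crux `PowerGaugeEulerLiouville` (a crux CLASS of self-similar Euler/NS strata on the
MODEL lattice — not NS regularity, not E).  Seat ns-ezl-w3 g7 (K-TJ′-PROOF, file (T); LEAD 19832 key 03:09:57Z/03:24:52Z;
nsreg-p2 g39 K-TJ′ TEXT `HasStraightSlowHighRuns` / `StraightSlowHighRunsMember`).  Class-free.

§1 RIGID MOTIONS `g x = A x + a` (`A` a linear isometry): the moved pair `(V′, P′) = (A⁻¹ ∘ V ∘ g, P ∘ g)` of a centre-`0` profile is a
profile with centre `c′ = A⁻¹(−a)` (`isSelfSimilarEulerProfile_rigid`, from the LEAD's t51-PIC + `comp_add_right`); its transport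
field is `A⁻¹(W ∘ g)` (`transport_rigid`), its derivative is `A⁻¹ ∘ DV(g·) ∘ A` with the SAME Frobenius norm (`frobeniusNormSq_fderiv_rigid`).
§2 ENERGY OF A MOVED CYLINDER: `∫_{solidCyl} |DV′|_F² ≤ ∫_{closedBall 0 R′} |DV|_F²` when `g` maps the cylinder into the ball
(change of variables by the measure-preserving `g`), and `∫_{closedBall} |DV|_F² ≤ 3·B` from the operator-norm budget `∫⁻ ‖DV‖ₑ² ≤ B` (`BradshawTsai2017.frobeniusNormSq_le_three_mul_norm_sq`).
§3 SIZE BOUNDS of the terms of the axis law / TJ-CORE under speed bounds on the tube (`‖V‖ ≤ M`) and on the wall circle (`‖V‖ ≤ N`):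
`|V_r|, |V_z| ≤ ‖V‖` (with `Wei2016.norm_eR_le_one'`), `V_r² + V_z² ≤ ‖V‖²`, `|circleAvg f| ≤ M`, `endFlux ≤ 2πT₀M²`, `|endTermC| ≤ T₀·…`, `|offsetTerm| ≤ |γ|T₀·…`,
the lateral average and the radial double integral.
WHAT THIS IS NOT: not NS, not E — bookkeeping for hypothetical profiles; 19832 OPEN; NS regularity NOT proved.  [folklore]
-/

noncomputable section

open MeasureTheory Set WithLp Metric Real Function
open scoped InnerProductSpace RealInnerProductSpace ENNReal Interval

set_option linter.dupNamespace false

namespace Summit.NavierStokesRegularity.NavierStokesRegularity.Theorems.PowerGaugeEulerLiouville.HoopCore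

open Literature.Analysis Literature.Analysis.FluidPDE

variable {V : EuclideanSpace ℝ (Fin 3) → EuclideanSpace ℝ (Fin 3)}

/-! ## §1 Rigid motions of profiles -/

/-- **A centre-`0` profile moved by the rigid motion `g x = A x + a` is a profile with centre `A⁻¹(−a)`**:
`(y ↦ A⁻¹ (V (A y + a)), y ↦ P (A y + a))` satisfies the profile system with exponent `γ` and centre `A.symm (−a)`. [folklore] -/
theorem isSelfSimilarEulerProfile_rigid {γ : ℝ} {P : EuclideanSpace ℝ (Fin 3) → ℝ} (h : IsSelfSimilarEulerProfile γ 0 V P)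
    (A : EuclideanSpace ℝ (Fin 3) ≃ₗᵢ[ℝ] EuclideanSpace ℝ (Fin 3)) (a : EuclideanSpace ℝ (Fin 3)) :
    IsSelfSimilarEulerProfile γ (A.symm (-a)) (fun y => A.symm (V (A y + a))) (fun y => P (A y + a)) := by
  have h2 := isSelfSimilarEulerProfile_conj_linearIsometryEquiv (h.comp_add_right a) A
  simpa only [zero_sub] using h2

/-- The transport field of the moved profile is the moved transport field: `γ(y − A⁻¹(−a)) + A⁻¹(V(Ay + a)) = A⁻¹(γ(Ay + a) + V(Ay + a))`.
[folklore] -/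
theorem transport_rigid (γ : ℝ) (A : EuclideanSpace ℝ (Fin 3) ≃ₗᵢ[ℝ] EuclideanSpace ℝ (Fin 3)) (a y : EuclideanSpace ℝ (Fin 3)) :
    γ • (y - A.symm (-a)) + A.symm (V (A y + a)) = A.symm (γ • (A y + a) + V (A y + a)) := by
  rw [map_add, map_smul, map_add, LinearIsometryEquiv.symm_apply_apply, map_neg, sub_neg_eq_add]

/-- Hence `‖γ(y − c′) + V′(y)‖ = ‖γ(g y) + V(g y)‖` for the moved profile. [folklore] -/
theorem norm_transport_rigid (γ : ℝ) (A : EuclideanSpace ℝ (Fin 3) ≃ₗᵢ[ℝ] EuclideanSpace ℝ (Fin 3)) (a y : EuclideanSpace ℝ (Fin 3)) :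
    ‖γ • (y - A.symm (-a)) + A.symm (V (A y + a))‖ = ‖γ • (A y + a) + V (A y + a)‖ := by
  rw [transport_rigid, LinearIsometryEquiv.norm_map]

/-- Distances to the moved centre are distances of the moved points to the origin: `‖y − A⁻¹(−a)‖ = ‖A y + a‖`. [folklore] -/
theorem norm_sub_centre_rigid (A : EuclideanSpace ℝ (Fin 3) ≃ₗᵢ[ℝ] EuclideanSpace ℝ (Fin 3)) (a y : EuclideanSpace ℝ (Fin 3)) :
    ‖y - A.symm (-a)‖ = ‖A y + a‖ := by
  rw [← A.norm_map (y - A.symm (-a)), map_sub, LinearIsometryEquiv.apply_symm_apply, sub_neg_eq_add]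

/-- The Bernoulli function of the moved profile is the moved Bernoulli function: `ℋ′(y) = ℋ(A y + a)`. [folklore] -/
theorem selfSimilarBernoulli_rigid (γ : ℝ) (P : EuclideanSpace ℝ (Fin 3) → ℝ) (A : EuclideanSpace ℝ (Fin 3) ≃ₗᵢ[ℝ] EuclideanSpace ℝ (Fin 3))
    (a y : EuclideanSpace ℝ (Fin 3)) :
    selfSimilarBernoulli γ (A.symm (-a)) (fun y => A.symm (V (A y + a))) (fun y => P (A y + a)) y =
      selfSimilarBernoulli γ 0 V P (A y + a) := by
  simp only [selfSimilarBernoulli_apply, norm_transport_rigid, norm_sub_centre_rigid, sub_zero]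

/-- **Derivative of the moved field**: `D(A⁻¹ ∘ V ∘ g)(y) = A⁻¹ ∘ DV(g y) ∘ A` (`V` differentiable). [folklore] -/
theorem fderiv_rigid (V : EuclideanSpace ℝ (Fin 3) → EuclideanSpace ℝ (Fin 3)) (A : EuclideanSpace ℝ (Fin 3) ≃ₗᵢ[ℝ] EuclideanSpace ℝ (Fin 3)) (a y : EuclideanSpace ℝ (Fin 3)) :
    fderiv ℝ (fun y => A.symm (V (A y + a))) y =
      ((A.symm.toContinuousLinearEquiv : EuclideanSpace ℝ (Fin 3) →L[ℝ] EuclideanSpace ℝ (Fin 3)).comp (fderiv ℝ V (A y + a))).comp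
        (A.toContinuousLinearEquiv : EuclideanSpace ℝ (Fin 3) →L[ℝ] EuclideanSpace ℝ (Fin 3)) := by
  set M : EuclideanSpace ℝ (Fin 3) ≃L[ℝ] EuclideanSpace ℝ (Fin 3) := A.toContinuousLinearEquiv with hM_def
  have e : (fun y => A.symm (V (A y + a))) = (⇑M.symm ∘ fun z => V (z + a)) ∘ ⇑M := by
    funext y; simp only [Function.comp_apply]; rfl
  rw [e, ContinuousLinearEquiv.comp_right_fderiv, ContinuousLinearEquiv.comp_fderiv, fderiv_comp_add_right]
  rfl

/-- **The Frobenius norm of the derivative is invariant under the rigid motion**: `|D(A⁻¹ ∘ V ∘ g)(y)|_F² = |DV(g y)|_F²`. [folklore] -/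
theorem frobeniusNormSq_fderiv_rigid (V : EuclideanSpace ℝ (Fin 3) → EuclideanSpace ℝ (Fin 3))
    (A : EuclideanSpace ℝ (Fin 3) ≃ₗᵢ[ℝ] EuclideanSpace ℝ (Fin 3)) (a y : EuclideanSpace ℝ (Fin 3)) :
    frobeniusNormSq (fderiv ℝ (fun y => A.symm (V (A y + a))) y) = frobeniusNormSq (fderiv ℝ V (A y + a)) := by
  rw [fderiv_rigid V A a y, frobeniusNormSq_eq_sum (EuclideanSpace.basisFun (Fin 3) ℝ),
    frobeniusNormSq_eq_sum ((EuclideanSpace.basisFun (Fin 3) ℝ).map A)]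
  refine Finset.sum_congr rfl fun i _ => ?_
  simp only [ContinuousLinearMap.comp_apply, OrthonormalBasis.map_apply]
  congr 1
  exact A.symm.norm_map _

/-! ## §2 The Dirichlet energy of a moved cylinder -/

/-- The Frobenius energy density of a `C¹` field is continuous. [folklore] -/
theorem continuous_frobeniusNormSq_fderiv (hV : ContDiff ℝ 1 V) : Continuous fun y => frobeniusNormSq (fderiv ℝ V y) := by
  unfold frobeniusNormSq
  exact continuous_finsetSum _ fun i _ => (((hV.continuous_fderiv one_ne_zero).clm_apply continuous_const).norm).pow 2

/-- The rigid motion `x ↦ A x + a` preserves Lebesgue measure. [folklore] -/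
theorem measurePreserving_rigid (A : EuclideanSpace ℝ (Fin 3) ≃ₗᵢ[ℝ] EuclideanSpace ℝ (Fin 3)) (a : EuclideanSpace ℝ (Fin 3)) :
    MeasurePreserving (fun x : EuclideanSpace ℝ (Fin 3) => A x + a) volume volume :=
  (measurePreserving_add_right volume a).comp A.measurePreserving

/-- The rigid motion `x ↦ A x + a` is a measurable embedding (it is a homeomorphism). [folklore] -/
theorem measurableEmbedding_rigid (A : EuclideanSpace ℝ (Fin 3) ≃ₗᵢ[ℝ] EuclideanSpace ℝ (Fin 3)) (a : EuclideanSpace ℝ (Fin 3)) :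
    MeasurableEmbedding (fun x : EuclideanSpace ℝ (Fin 3) => A x + a) :=
  (A.toHomeomorph.trans (Homeomorph.addRight a)).measurableEmbedding

/-- **THE DIRICHLET ENERGY OF A MOVED CYLINDER IS AT MOST THAT OF A BALL CONTAINING ITS IMAGE**: if `g x = A x + a` maps
`solidCyl s₁ s₂ T₀` into `closedBall 0 R′`, then `∫_{solidCyl} |D(A⁻¹∘V∘g)|_F² ≤ ∫_{closedBall 0 R′} |DV|_F²` (`V ∈ C¹`). [folklore] -/
theorem setIntegral_frobeniusNormSq_rigid_le (hV : ContDiff ℝ 1 V) (A : EuclideanSpace ℝ (Fin 3) ≃ₗᵢ[ℝ] EuclideanSpace ℝ (Fin 3))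
    (a : EuclideanSpace ℝ (Fin 3)) {s₁ s₂ T₀ R' : ℝ} (hsub : ∀ x ∈ solidCyl s₁ s₂ T₀, ‖A x + a‖ ≤ R') :
    ∫ x in solidCyl s₁ s₂ T₀, frobeniusNormSq (fderiv ℝ (fun y => A.symm (V (A y + a))) x)
      ≤ ∫ y in Metric.closedBall (0 : EuclideanSpace ℝ (Fin 3)) R', frobeniusNormSq (fderiv ℝ V y) := by
  have hc := continuous_frobeniusNormSq_fderiv hV
  simp_rw [frobeniusNormSq_fderiv_rigid V A a]
  rw [← (measurePreserving_rigid A a).setIntegral_image_emb (measurableEmbedding_rigid A a)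
    (fun y => frobeniusNormSq (fderiv ℝ V y)) (solidCyl s₁ s₂ T₀)]
  refine setIntegral_mono_set (hc.continuousOn.integrableOn_compact (isCompact_closedBall _ _))
    (Filter.Eventually.of_forall fun y => frobeniusNormSq_nonneg _) (Filter.Eventually.of_forall ?_)
  rintro y ⟨x, hx, rfl⟩
  exact mem_closedBall_zero_iff.2 (hsub x hx)

/-- **Frobenius energy of a ball from the operator-norm budget**: if `∫⁻_{closedBall 0 R′} ‖DV‖ₑ² ≤ B` (`B ≥ 0`, `V ∈ C¹`) then
`∫_{closedBall 0 R′} |DV|_F² ≤ 3 B`. [folklore] -/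
theorem setIntegral_frobeniusNormSq_closedBall_le (hV : ContDiff ℝ 1 V) {R' B : ℝ} (hB : 0 ≤ B)
    (hE : ∫⁻ z in Metric.closedBall (0 : EuclideanSpace ℝ (Fin 3)) R', ‖fderiv ℝ V z‖ₑ ^ 2 ≤ ENNReal.ofReal B) :
    ∫ y in Metric.closedBall (0 : EuclideanSpace ℝ (Fin 3)) R', frobeniusNormSq (fderiv ℝ V y) ≤ 3 * B := by
  have hcF := continuous_frobeniusNormSq_fderiv hV
  have hcn : Continuous fun y => ‖fderiv ℝ V y‖ ^ 2 := ((hV.continuous_fderiv one_ne_zero).norm).pow 2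
  have hK : IsCompact (Metric.closedBall (0 : EuclideanSpace ℝ (Fin 3)) R') := isCompact_closedBall _ _
  have hiF : IntegrableOn (fun y => frobeniusNormSq (fderiv ℝ V y)) (Metric.closedBall 0 R') := hcF.continuousOn.integrableOn_compact hK
  have hin : IntegrableOn (fun y => ‖fderiv ℝ V y‖ ^ 2) (Metric.closedBall 0 R') := hcn.continuousOn.integrableOn_compact hK
  -- the Bochner integral of `‖DV‖²` is at most `B`
  have h1 : ∫ y in Metric.closedBall (0 : EuclideanSpace ℝ (Fin 3)) R', ‖fderiv ℝ V y‖ ^ 2 ≤ B := by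
    rw [integral_eq_lintegral_of_nonneg_ae (Filter.Eventually.of_forall fun y => sq_nonneg _) hin.aestronglyMeasurable]
    refine ENNReal.toReal_le_of_le_ofReal hB (le_trans (le_of_eq ?_) hE)
    refine lintegral_congr fun y => ?_
    rw [← ofReal_norm, ENNReal.ofReal_pow (norm_nonneg _)]
  calc ∫ y in Metric.closedBall (0 : EuclideanSpace ℝ (Fin 3)) R', frobeniusNormSq (fderiv ℝ V y)
      ≤ ∫ y in Metric.closedBall (0 : EuclideanSpace ℝ (Fin 3)) R', 3 * ‖fderiv ℝ V y‖ ^ 2 :=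
        setIntegral_mono_on hiF (hin.const_mul 3) measurableSet_closedBall fun y _ => BradshawTsai2017.frobeniusNormSq_le_three_mul_norm_sq _
    _ = 3 * ∫ y in Metric.closedBall (0 : EuclideanSpace ℝ (Fin 3)) R', ‖fderiv ℝ V y‖ ^ 2 := integral_const_mul _ _
    _ ≤ 3 * B := by linarith

/-! ## §3 Size bounds of the axis-law terms -/

/-- `|⟪w, ê_r(y)⟫| ≤ ‖w‖`. [folklore] -/
theorem abs_inner_eR_le (w y : EuclideanSpace ℝ (Fin 3)) : |⟪w, eR y⟫| ≤ ‖w‖ :=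
  calc |⟪w, eR y⟫| ≤ ‖w‖ * ‖eR y‖ := abs_real_inner_le_norm _ _
    _ ≤ ‖w‖ * 1 := by gcongr; exact Wei2016.norm_eR_le_one' y
    _ = ‖w‖ := mul_one _

/-- `|V_r(y)| ≤ ‖V(y)‖` (everywhere: `‖ê_r‖ ≤ 1`, junk `0` on the axis). [folklore] -/
theorem abs_radialVelocity_le (V : EuclideanSpace ℝ (Fin 3) → EuclideanSpace ℝ (Fin 3)) (y : EuclideanSpace ℝ (Fin 3)) :
    |radialVelocity V y| ≤ ‖V y‖ :=
  abs_inner_eR_le (V y) y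

/-- `|V_z(y)| ≤ ‖V(y)‖`. [folklore] -/
theorem abs_axialVelocity_le (V : EuclideanSpace ℝ (Fin 3) → EuclideanSpace ℝ (Fin 3)) (y : EuclideanSpace ℝ (Fin 3)) :
    |axialVelocity V y| ≤ ‖V y‖ := by
  simpa only [Real.norm_eq_abs, axialVelocity] using PiLp.norm_apply_le (V y) 2

/-- On a circle point off the axis (`t > 0`), `V_r² + V_z² ≤ ‖V‖²` (two orthonormal directions; Parseval in the polar frame). [folklore] -/
theorem radialVelocity_sq_add_axialVelocity_sq_le_norm_sq (V : EuclideanSpace ℝ (Fin 3) → EuclideanSpace ℝ (Fin 3)) (σ : ℝ) {t : ℝ}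
    (ht : 0 < t) (θ : ℝ) :
    radialVelocity V (axisPt σ t θ) ^ 2 + axialVelocity V (axisPt σ t θ) ^ 2 ≤ ‖V (axisPt σ t θ)‖ ^ 2 := by
  have h := norm_sq_eq_polarFrame (V (axisPt σ t θ)) σ ht θ
  have hz : axialVelocity V (axisPt σ t θ) = ⟪V (axisPt σ t θ), eZ⟫ := by
    simp [axialVelocity, eZ, EuclideanSpace.inner_single_right]
  rw [radialVelocity, hz, h]
  nlinarith [sq_nonneg ⟪V (axisPt σ t θ), eTheta (axisPt σ t θ)⟫]

/-- **A circle average is bounded by a bound of the integrand on the circle**: `(∀ θ, |f(axisPt s t θ)| ≤ M) → |circleAvg f s t| ≤ M`.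
[folklore] -/
theorem abs_circleAvg_le {f : EuclideanSpace ℝ (Fin 3) → ℝ} {s t M : ℝ} (hM : ∀ θ : ℝ, |f (axisPt s t θ)| ≤ M) :
    |circleAvg f s t| ≤ M := by
  have hπ : 0 < 2 * Real.pi := by positivity
  have h := intervalIntegral.norm_integral_le_of_norm_le_const (a := 0) (b := 2 * Real.pi) (C := M)
    (f := fun θ => f (axisPt s t θ)) fun θ _ => by rw [Real.norm_eq_abs]; exact hM θ
  rw [Real.norm_eq_abs, sub_zero, abs_of_pos hπ] at h
  rw [circleAvg, abs_mul, abs_of_pos (by positivity : (0 : ℝ) < 1 / (2 * Real.pi))]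
  calc 1 / (2 * Real.pi) * |∫ θ in (0 : ℝ)..2 * Real.pi, f (axisPt s t θ)| ≤ 1 / (2 * Real.pi) * (M * (2 * Real.pi)) := by gcongr
    _ = M := by field_simp

/-- **End-disc flux under a speed bound**: if `‖V‖ ≤ M` at the points `axisPt σ t θ`, `0 < t ≤ T₀` (the disc, off its centre), then
`endFlux V σ T₀ ≤ 2π T₀ M²` (`V` continuous, `T₀ > 0`). [folklore] -/
theorem endFlux_le_of_norm_le (hV : Continuous V) (σ : ℝ) {T₀ M : ℝ} (hT₀ : 0 < T₀)
    (hM : ∀ t ∈ Ioc 0 T₀, ∀ θ : ℝ, ‖V (axisPt σ t θ)‖ ≤ M) :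
    endFlux V σ T₀ ≤ 2 * Real.pi * T₀ * M ^ 2 := by
  rw [endFlux_eq hV σ hT₀]
  have hπ : 0 < 2 * Real.pi := by positivity
  have hinner : ∀ t ∈ Ι 0 T₀, ‖∫ θ in (0 : ℝ)..2 * π,
      (radialVelocity V (axisPt σ t θ) ^ 2 + axialVelocity V (axisPt σ t θ) ^ 2)‖ ≤ M ^ 2 * (2 * Real.pi) := by
    intro t ht
    rw [uIoc_of_le hT₀.le] at ht
    have h := intervalIntegral.norm_integral_le_of_norm_le_const (a := 0) (b := 2 * Real.pi) (C := M ^ 2)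
      (f := fun θ => radialVelocity V (axisPt σ t θ) ^ 2 + axialVelocity V (axisPt σ t θ) ^ 2) fun θ _ => by
        rw [Real.norm_eq_abs, abs_of_nonneg (by positivity)]
        calc radialVelocity V (axisPt σ t θ) ^ 2 + axialVelocity V (axisPt σ t θ) ^ 2
            ≤ ‖V (axisPt σ t θ)‖ ^ 2 := radialVelocity_sq_add_axialVelocity_sq_le_norm_sq V σ ht.1 θ
          _ ≤ M ^ 2 := pow_le_pow_left₀ (norm_nonneg _) (hM t ht θ) 2
    rwa [sub_zero, abs_of_pos hπ] at h
  have h := intervalIntegral.norm_integral_le_of_norm_le_const (a := 0) (b := T₀) (C := M ^ 2 * (2 * Real.pi)) hinner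
  rw [sub_zero, abs_of_pos hT₀] at h
  have h' := le_trans (le_abs_self _) (Real.norm_eq_abs _ ▸ h)
  linarith

/-- **The end functional under size bounds**: if `|(γ(y₂ − c₂) + V_z(y))·V_r(y)| ≤ M` at the points `axisPt σ t θ`, `0 < t ≤ T₀`,
then `|endTermC γ c V T₀ σ| ≤ T₀ M` (`T₀ ≥ 0`). [folklore] -/
theorem abs_endTermC_le {γ : ℝ} {c : EuclideanSpace ℝ (Fin 3)} {T₀ M : ℝ} (hT₀ : 0 ≤ T₀) (σ : ℝ)
    (hM : ∀ t ∈ Ioc 0 T₀, ∀ θ : ℝ,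
      |(γ * (axisPt σ t θ 2 - c 2) + axialVelocity V (axisPt σ t θ)) * radialVelocity V (axisPt σ t θ)| ≤ M) :
    |endTermC γ c V T₀ σ| ≤ T₀ * M := by
  rw [endTermC]
  have h := intervalIntegral.norm_integral_le_of_norm_le_const (a := 0) (b := T₀) (C := M)
    (f := fun t => circleAvg (fun y => (γ * (y 2 - c 2) + axialVelocity V y) * radialVelocity V y) σ t) fun t ht => by
      rw [uIoc_of_le hT₀] at ht
      rw [Real.norm_eq_abs]
      exact abs_circleAvg_le fun θ => hM t ht θ
  rw [Real.norm_eq_abs, sub_zero, abs_of_nonneg hT₀] at h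
  linarith

/-- **The offset functional under size bounds**: if `|(−(c₀ê_r⁰ + c₁ê_r¹))·V_z| ≤ M` at the points `axisPt σ t θ`, `0 < t ≤ T₀`, then
`|offsetTerm γ c V T₀ σ| ≤ |γ| T₀ M` (`T₀ ≥ 0`). [folklore] -/
theorem abs_offsetTerm_le {γ : ℝ} {c : EuclideanSpace ℝ (Fin 3)} {T₀ M : ℝ} (hT₀ : 0 ≤ T₀) (σ : ℝ)
    (hM : ∀ t ∈ Ioc 0 T₀, ∀ θ : ℝ,
      |(-(c 0 * eR (axisPt σ t θ) 0 + c 1 * eR (axisPt σ t θ) 1)) * axialVelocity V (axisPt σ t θ)| ≤ M) :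
    |offsetTerm γ c V T₀ σ| ≤ |γ| * T₀ * M := by
  rw [offsetTerm, abs_mul]
  have h := intervalIntegral.norm_integral_le_of_norm_le_const (a := 0) (b := T₀) (C := M)
    (f := fun t => circleAvg (fun y => (-(c 0 * eR y 0 + c 1 * eR y 1)) * axialVelocity V y) σ t) fun t ht => by
      rw [uIoc_of_le hT₀] at ht
      rw [Real.norm_eq_abs]
      exact abs_circleAvg_le fun θ => hM t ht θ
  rw [Real.norm_eq_abs, sub_zero, abs_of_nonneg hT₀] at h
  calc |γ| * |∫ t in (0 : ℝ)..T₀, circleAvg (fun y => (-(c 0 * eR y 0 + c 1 * eR y 1)) * axialVelocity V y) σ t|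
      ≤ |γ| * (M * T₀) := by gcongr
    _ = |γ| * T₀ * M := by ring

/-- **The lateral average under a wall speed bound**: if `‖V(axisPt σ T₀ θ)‖ ≤ N` on the wall circle (`T₀ ≥ 0`, `N ≥ 0`) then
`|⟨(γr + V_r)V_r⟩_θ(σ,T₀)| ≤ (|γ|T₀ + N)·N`. [folklore] -/
theorem abs_circleAvg_lateral_le {γ σ T₀ N : ℝ} (hT₀ : 0 ≤ T₀) (hN : 0 ≤ N) (hwall : ∀ θ : ℝ, ‖V (axisPt σ T₀ θ)‖ ≤ N) :
    |circleAvg (fun y => (γ * cylRadius y + radialVelocity V y) * radialVelocity V y) σ T₀| ≤ (|γ| * T₀ + N) * N := by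
  refine abs_circleAvg_le fun θ => ?_
  have hr : cylRadius (axisPt σ T₀ θ) = T₀ := cylRadius_axisPt σ hT₀ θ
  have hv : |radialVelocity V (axisPt σ T₀ θ)| ≤ N := (abs_radialVelocity_le V _).trans (hwall θ)
  rw [hr, abs_mul]
  have h1 : |γ * T₀ + radialVelocity V (axisPt σ T₀ θ)| ≤ |γ| * T₀ + N := by
    calc |γ * T₀ + radialVelocity V (axisPt σ T₀ θ)| ≤ |γ * T₀| + |radialVelocity V (axisPt σ T₀ θ)| := abs_add_le _ _
      _ ≤ |γ| * T₀ + N := by rw [abs_mul, abs_of_nonneg hT₀]; gcongr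
  exact mul_le_mul h1 hv (abs_nonneg _) (by positivity)

/-- **The radial double integral under a speed bound**: if `‖V‖ ≤ M` at the points `axisPt σ t θ` (`σ ∈ [s₁,s₂]`, `0 < t ≤ T₀`)
then `|∫_{s₁}^{s₂}∫₀^{T₀} ⟨V_r⟩_θ dt dσ| ≤ (s₂ − s₁) T₀ M` (`s₁ ≤ s₂`, `T₀ ≥ 0`). [folklore] -/
theorem abs_integral_integral_circleAvg_radialVelocity_le {s₁ s₂ T₀ M : ℝ} (hs : s₁ ≤ s₂) (hT₀ : 0 ≤ T₀)
    (hM : ∀ σ ∈ Icc s₁ s₂, ∀ t ∈ Ioc 0 T₀, ∀ θ : ℝ, ‖V (axisPt σ t θ)‖ ≤ M) :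
    |∫ σ in s₁..s₂, ∫ t in (0 : ℝ)..T₀, circleAvg (radialVelocity V) σ t| ≤ (s₂ - s₁) * T₀ * M := by
  have hinner : ∀ σ ∈ Ι s₁ s₂, ‖∫ t in (0 : ℝ)..T₀, circleAvg (radialVelocity V) σ t‖ ≤ M * T₀ := by
    intro σ hσ
    rw [uIoc_of_le hs] at hσ
    have h := intervalIntegral.norm_integral_le_of_norm_le_const (a := 0) (b := T₀) (C := M)
      (f := fun t => circleAvg (radialVelocity V) σ t) fun t ht => by
        rw [uIoc_of_le hT₀] at ht
        rw [Real.norm_eq_abs]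
        exact abs_circleAvg_le fun θ => (abs_radialVelocity_le V _).trans (hM σ ⟨hσ.1.le, hσ.2⟩ t ht θ)
    rw [sub_zero, abs_of_nonneg hT₀] at h
    linarith
  have h := intervalIntegral.norm_integral_le_of_norm_le_const (a := s₁) (b := s₂) (C := M * T₀) hinner
  rw [Real.norm_eq_abs, abs_of_nonneg (by linarith : (0 : ℝ) ≤ s₂ - s₁)] at h
  calc |∫ σ in s₁..s₂, ∫ t in (0 : ℝ)..T₀, circleAvg (radialVelocity V) σ t| ≤ M * T₀ * (s₂ - s₁) := h
    _ = (s₂ - s₁) * T₀ * M := by ring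

end Summit.NavierStokesRegularity.NavierStokesRegularity.Theorems.PowerGaugeEulerLiouville.HoopCore

end
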